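import Summits.CriticalPhenomena.CardyFormulaZ2.Theses.CardyBondTriangular
import Summits.CriticalPhenomena.CardyFormulaZ2.Theses.CardyIsoradial
import Summits.CriticalPhenomena.CardyFormulaZ2.Theorems.CardyBondTriangularTriangularToSquareTransportOfCLI
import HarnessLib

/-!
# Strategist r1 sketch — how far `BondTriangularCardy` (stmt-CriticalPhenomena-4664) is from the summit

Kernel-checked logic behind the r1 STRATEGY-CENSUS verdict.  Nothing here is a new crux or a line;
these are typed statements and two small theorems recording that the crux is the sub-problem
`CardyFormulaZ2` up to (i) the symmetric star–triangle transport `CrossingLimitInvariance`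
(route CardyIsoradial, stmt-CriticalPhenomena-0785 — in print for the rectangular family 𝕃(α) only,
DKKMO2020 Thm 2.1; announced for all bi-periodic isoradial graphs, 𝕋 and ℤ² included, in [HM24],
Manolescu arXiv:2502.08394 Rem 5.6) and (ii) the two directions of the ℤ² discretisation bridge
(forward = stmt-0787, proved; converse typed below, same boundary-RSW content).

* `CrudeSquareCardy` — Cardy for the crude event of bond-ℤ² at 1/2 (the hypothesis of 0787).
* `SquareToTriangularTransport` — the (ℤ² → 𝕋) direction of 0785; proved from 0785 exactly as the
  landed `triangularToSquareTransport_of_crossingLimitInvariance` proves the (𝕋 → ℤ²) direction.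
* `bondTriangularCardy_iff_crudeSquareCardy` — 0785 ⊢ crux ↔ crude summit.
* `bondTriangularCardy_iff_cardyFormulaZ2` — 0785, 0787, converse bridge ⊢ crux ↔ `CardyFormulaZ2`.
-/

namespace Summit.CriticalPhenomena.CardyFormulaZ2.Cruxes.BondTriangularCardy.StrategistR1

open Literature.Probability.LatticeModels Literature.Probability.Percolation
open Summit.CriticalPhenomena.CardyFormulaZ2.Theses
open Summit.CriticalPhenomena.CardyFormulaZ2.Theorems

/-- Cardy's formula for the crude crossing event `embDomainCrossing squareLatticeEmbedding.z` of
bond percolation on ℤ² at `p = 1/2` — the hypothesis of `CardyIsoradial.DiscretisationBridge`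
(stmt-0787) and the conclusion of `CardyBondTriangular.TriangularToSquareTransport` at
`Φ = cardyFunction`. -/
def CrudeSquareCardy : Prop :=
  ∀ R : Literature.Probability.RandomPlanarGeometry.ConformalRectangle,
    R.HasCrossingLimit (fun δ ↦ (bondPercolation (zdGraph 2) half).real
      (embDomainCrossing squareLatticeEmbedding.z R.carrier δ (R.arc 0) (R.arc 2)))
      Literature.Probability.RandomPlanarGeometry.cardyFunction

/-- The (ℤ² → 𝕋) direction of `CrossingLimitInvariance`: whatever crude crossing limits bond-ℤ² at
1/2 has for all conformal rectangles, canonical bond-𝕋 (drawing `√3 (triEmbed − (1+ζ)/3)`) has the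
same. -/
def SquareToTriangularTransport : Prop :=
  ∀ Φ : ℝ → ℝ,
    (∀ R : Literature.Probability.RandomPlanarGeometry.ConformalRectangle,
      R.HasCrossingLimit (fun δ ↦ (bondPercolation (zdGraph 2) half).real
        (embDomainCrossing squareLatticeEmbedding.z R.carrier δ (R.arc 0) (R.arc 2))) Φ) →
    ∀ R : Literature.Probability.RandomPlanarGeometry.ConformalRectangle,
      R.HasCrossingLimit (fun δ ↦ (bondPercolation triGraph (criticalWeightI (Real.pi / 6))).real
        (embDomainCrossing (fun x : Site 2 ↦ (Real.sqrt 3 : ℂ) * (triEmbed x - (1 + triZeta) / 3))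
          R.carrier δ (R.arc 0) (R.arc 2))) Φ

/-- `CrossingLimitInvariance → SquareToTriangularTransport`: instantiate universality over 𝒢 at the
members ℤ² (six square-lattice instance theorems) and 𝕋 (`triIsoradialInstance_proof`). -/
theorem squareToTriangularTransport_of_crossingLimitInvariance
    (hCLI : CardyIsoradial.CrossingLimitInvariance) : SquareToTriangularTransport := by
  intro Φ hS R
  obtain ⟨hpre, emb, hz, hiso, htile, hsgp, hbap, hlaw⟩ := triIsoradialInstance_proof
  have hS' : ∀ R : Literature.Probability.RandomPlanarGeometry.ConformalRectangle,
      R.HasCrossingLimit (fun δ ↦ squareLatticeEmbedding.isoradialPercolation.real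
        (embDomainCrossing squareLatticeEmbedding.z R.carrier δ (R.arc 0) (R.arc 2))) Φ := by
    intro R'
    rw [RhombicEmbedding.isoradialPercolation_squareLattice_holds]
    exact hS R'
  have h := hCLI Φ (Site 2) (Site 2) (zdGraph 2) squareLatticeEmbedding
    zdGraph_preconnected_holds isIsoradial_squareLatticeEmbedding_holds
    isRhombicTiling_squareLatticeEmbedding_holds hasSquareGridProperty_squareLattice_holds
    (Real.pi / 4) (by positivity) (hasBoundedAngles_squareLatticeEmbedding_holds le_rfl) hS'
    (Site 2) HexVertex triGraph emb hpre hiso htile hsgp (Real.pi / 6) (by positivity) hbap R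
  rw [hz, hlaw] at h
  exact h

/-- **Crux ↔ crude summit, given stmt-0785.**  `CrossingLimitInvariance` is symmetric in the two
graphs, so it makes `BondTriangularCardy` (stmt-4664) and `CrudeSquareCardy` equivalent. -/
theorem bondTriangularCardy_iff_crudeSquareCardy (hCLI : CardyIsoradial.CrossingLimitInvariance) :
    CardyBondTriangular.BondTriangularCardy ↔ CrudeSquareCardy :=
  ⟨fun hT R => triangularToSquareTransport_of_crossingLimitInvariance hCLI _ hT R,
   fun hS R => squareToTriangularTransport_of_crossingLimitInvariance hCLI _ hS R⟩

/-- Converse of the (proved) discretisation bridge stmt-0787: Cardy for G02's largest-component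
event `bondDomainCrossingProb` implies Cardy for the crude event.  Same boundary-RSW rerouting
content as 0787 (re-route near ∂Ω at o(1) cost), other direction; not filed as an item. -/
def DiscretisationBridgeConverse : Prop :=
  ∀ R : Literature.Probability.RandomPlanarGeometry.ConformalRectangle,
    R.HasCrossingLimit (bondDomainCrossingProb R) Literature.Probability.RandomPlanarGeometry.cardyFunction →
    R.HasCrossingLimit (fun δ ↦ (bondPercolation (zdGraph 2) half).real
      (embDomainCrossing squareLatticeEmbedding.z R.carrier δ (R.arc 0) (R.arc 2)))
      Literature.Probability.RandomPlanarGeometry.cardyFunction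

/-- **Crux ↔ summit, given stmt-0785 and the two bridge directions.** -/
theorem bondTriangularCardy_iff_cardyFormulaZ2 (hCLI : CardyIsoradial.CrossingLimitInvariance)
    (hB : CardyIsoradial.DiscretisationBridge) (hB' : DiscretisationBridgeConverse) :
    CardyBondTriangular.BondTriangularCardy ↔ _root_.CardyFormulaZ2 := by
  rw [bondTriangularCardy_iff_crudeSquareCardy hCLI]
  exact ⟨fun hS R => hB R (hS R), fun hZ R => hB' R (hZ R)⟩

/-- The summit is `CrudeSquareCardy` up to the bridge alone (no transport needed). -/
theorem cardyFormulaZ2_iff_crudeSquareCardy (hB : CardyIsoradial.DiscretisationBridge)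
    (hB' : DiscretisationBridgeConverse) : _root_.CardyFormulaZ2 ↔ CrudeSquareCardy :=
  ⟨fun hZ R => hB' R (hZ R), fun hS R => hB R (hS R)⟩

end Summit.CriticalPhenomena.CardyFormulaZ2.Cruxes.BondTriangularCardy.StrategistR1
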